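import Literature.NumberTheory.QuadraticFields.InfrastructureGiantStep
import Literature.NumberTheory.QuadraticFields.FormIdealsStructure
import Literature.Computability.Cryptography.InfrastructurePrimitives
import HarnessLib

/-!
# The cycle of reduced ideals of an ideal class, I: the ideals of ideal-shaped quotients

Topic `NumberTheory/QuadraticFields`; continues `ReducedQuadraticIrrationals*.lean` (the quotients
`x = (P + √D)/Q : QuadIrr D`, `step`, `IsReduced`, `valProd`, `psiProd`),
`QuadraticIrrationalDuplication.lean` / `InfrastructureGiantStep.lean` (`QuadIrr.IsIdealShaped x`:
`Q > 0` even and `2Q ∣ P² − D`, i.e. `x ↔` the primitive ideal `[Q/2, (P + √D)/2]`, `fa x = Q/2`,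
stable under the step) and `FormIdeals*.lean` (the ideals `(A, ω − k)` of `𝓞 K` in a `ℤ`-basis
`(1, ω)` of `𝓞 K` with `ω² = n + tω`). Pure-proof file (theorems only, no definitions, no named
facts), following Jacobson–Williams, *Solving the Pell Equation*, §5.1 and §5.3, for an ARBITRARY
ideal (class) — the principal cycle being `RealQuadraticPrincipalCycle.lean` /
`PrincipalCycleIdentification.lean`:

* `QuadIrr.IsIdealShaped.iterate` — ideal-shapedness along the cycle (with
  `InfraPrimitives.isIdealShaped_shiftP/normalize/step` of `InfrastructurePrimitives.lean`);
  `IsReduced.pair_cast/pair_spec`, `pair_inj` — the integer pair `(a, b) = ((Q/2).toNat, P.toNat)`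
  of a reduced ideal-shaped quotient satisfies the reduced-ideal inequalities of (3.32) as integer
  inequalities (`a, b ≥ 1`, `b² < D < (2a + b)²`, `2a ≤ b ∨ (2a − b)² < D`, `4a ∣ D − b²`) and
  determines the quotient; `IsReduced.val_lt_two_sqrt` (`φ < 2√D`), `IsPreReduced.log_valProd_le`
  (`log ∏_{k=1}^{n} φ_k ≤ n log(2√D)`), `psiProd_eq_valProd_of_iterate_eq`;
* the ideal `𝔞(x) = Ideal.span {fa x, ω − (t − P)/2} = [Q/2, (P + √D)/2]` of `𝓞 K` (when
  `2ω − t = √D`): `Quadratic.exists_form_of_isIdealShaped` (its form data `Q = 2A`, `P = t − 2k`,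
  `AC = k² − tk − n`), `span_fa_mem_nonZeroDivisors`, `gen_ne_zero`, `span_fa_shiftP`,
  `span_fa_normalize`;
* `Quadratic.span_fa_mul_span_fa_stepWith` — **the baby step in `𝓞 K`: `(A) · 𝔞' = (η') · 𝔞`**
  (op. cit. (5.4)–(5.5), `𝔞_{k+1} = ψ_k 𝔞_k` up to principal factors; key identity
  `η η' = AA' + qAη'`), iterated along the cycle in `span_prod_fa_mul_span_fa_iterate`
  (`(A₀⋯A_{m−1}) 𝔞_m = (η₁⋯η_m) 𝔞₀`, op. cit. (5.10)).

The sequel `ReducedIdealsPerClass.lean` evaluates these under a real embedding, extracts the unit of a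
period and counts the reduced ideals of a class.

## References

* M. J. Jacobson, Jr., H. C. Williams, *Solving the Pell Equation*, CMS Books in Mathematics,
  Springer (2009), §3.3 (3.32), §5.1 (5.4)–(5.10) and Thm. 5.9, §5.3 (5.33)–(5.34). [JacobsonWilliams2008]
* R. Jozsa, *Notes on Hallgren's efficient quantum algorithm for solving Pell's equation*,
  arXiv:quant-ph/0302134 (2003), §5 Prop. 16, §6.2 Prop. 19. [Jozsa2003]
* D. A. Cox, *Primes of the form x² + ny²*, 2nd ed., Wiley (2013), §7.B Thm. 7.7. [Cox2013]
-/

noncomputable section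

open Module NumberField Literature.Computability.Cryptography
open scoped Classical nonZeroDivisors NumberField

namespace Literature.NumberTheory.QuadraticFields

namespace QuadIrr

variable {D : ℕ}

/-! ### Ideal-shaped quotients along the cycle and their integer pairs -/

/-- All iterates of the step of a reduced ideal-shaped quotient are ideal-shaped.
[cite: Jozsa2003, §6.2 Prop. 19] -/
theorem IsIdealShaped.iterate (hD : ¬ IsSquare D) {x : QuadIrr D} (h : x.IsIdealShaped)
    (hr : x.IsReduced) : ∀ n : ℕ, (QuadIrr.step^[n] x).IsIdealShaped
  | 0 => h
  | n + 1 => by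
    rw [Function.iterate_succ_apply']
    exact (IsIdealShaped.iterate hD h hr n).step hD (isReduced_iterate hD hr n).isPreReduced

/-- For a reduced ideal-shaped quotient the natural numbers `a = (Q/2).toNat`, `b = P.toNat` — the
reduced ideal `[a, (b + √D)/2]` as an integer pair — satisfy `a = Q/2`, `b = P` in `ℤ`.
[cite: JacobsonWilliams2008, §5.3 (the ideal [Q/r, (P + √D)/r], r = 2)] -/
theorem IsReduced.pair_cast {x : QuadIrr D} (hr : x.IsReduced) (h : x.IsIdealShaped) :
    (((fa x).toNat : ℕ) : ℤ) = fa x ∧ ((x.P.toNat : ℕ) : ℤ) = x.P := by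
  have hQ := h.1
  have hfa : 0 ≤ fa x := by unfold fa; omega
  exact ⟨Int.toNat_of_nonneg hfa, Int.toNat_of_nonneg hr.P_pos.le⟩

/-- **A reduced ideal-shaped quotient `(b, 2a)` gives a reduced pair**: `a, b ≥ 1`, `b² < D`,
`4a ∣ D − b²`, `√D < 2a + b` and `2a ≤ b ∨ (2a − b)² < D` (i.e. `|2a − √D| < b`; all from (3.32):
`0 < P < √D`, `√D < P + Q`, `Q < P + √D`). [cite: JacobsonWilliams2008, §3.3 (3.32)] -/
theorem IsReduced.pair_spec {x : QuadIrr D} (hr : x.IsReduced) (h : x.IsIdealShaped) :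
    0 < (fa x).toNat ∧ 0 < x.P.toNat ∧ x.P.toNat ^ 2 < D ∧ 4 * (fa x).toNat ∣ D - x.P.toNat ^ 2 ∧
      D < (2 * (fa x).toNat + x.P.toNat) ^ 2 ∧
      (2 * (fa x).toNat ≤ x.P.toNat ∨ (2 * (fa x).toNat - x.P.toNat) ^ 2 < D) := by
  obtain ⟨hfa, hP'⟩ := hr.pair_cast h
  set a := (fa x).toNat with ha
  set b := x.P.toNat with hb
  have hQ : x.Q = 2 * (a : ℤ) := by rw [hfa]; exact Q_eq_two_mul_fa h
  have hP : x.P = (b : ℤ) := hP'.symm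
  have h1 := hr.P_lt_sqrt
  have h2 := hr.sqrt_lt_P_add_Q
  have h3 := hr.Q_lt_P_add_sqrt
  have hP0 := hr.P_pos
  rw [hQ] at h2 h3
  rw [hP] at h1 h2 h3 hP0
  push_cast at h1 h2 h3
  have ha0 : 0 < a := by have := hr.1; omega
  have hb0 : 0 < b := by exact_mod_cast hP0
  have hbD : b ^ 2 < D := by
    have : (b : ℝ) ^ 2 < D := by
      rw [← Real.lt_sqrt (by positivity)]; exact h1
    exact_mod_cast this
  refine ⟨ha0, hb0, hbD, ?_, ?_, ?_⟩
  · -- `4a ∣ D − b²` from `2Q ∣ P² − D`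
    have hdvd := h.2.2
    rw [hQ, hP] at hdvd
    have hdvd' : ((4 * a : ℕ) : ℤ) ∣ ((D - b ^ 2 : ℕ) : ℤ) := by
      rw [Nat.cast_sub hbD.le]; push_cast
      rw [show (4 : ℤ) * a = 2 * (2 * a) by ring, ← dvd_neg, neg_sub]
      exact hdvd
    exact_mod_cast hdvd'
  · have : (D : ℝ) < (2 * a + b : ℕ) ^ 2 := by
      rw [← Real.sqrt_lt' (by positivity)]; push_cast; linarith
    exact_mod_cast this
  · rcases le_or_gt (2 * a) b with hle | hlt
    · exact Or.inl hle
    · right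
      have : ((2 * a - b : ℕ) : ℝ) ^ 2 < D := by
        rw [← Real.lt_sqrt (by positivity), Nat.cast_sub hlt.le]; push_cast; linarith
      exact_mod_cast this

/-- The pair `(Q/2, P)` is injective on reduced ideal-shaped quotients. [folklore] -/
theorem pair_inj {x y : QuadIrr D} (hx : x.IsReduced) (hxs : x.IsIdealShaped) (hy : y.IsReduced)
    (hys : y.IsIdealShaped) (h : ((fa x).toNat, x.P.toNat) = ((fa y).toNat, y.P.toNat)) : x = y := by
  obtain ⟨hfx, hPx⟩ := hx.pair_cast hxs
  obtain ⟨hfy, hPy⟩ := hy.pair_cast hys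
  simp only [Prod.mk.injEq] at h
  obtain ⟨h1, h2⟩ := h
  refine QuadIrr.ext ?_ ?_
  · rw [← hPx, ← hPy, h2]
  · rw [Q_eq_two_mul_fa hxs, Q_eq_two_mul_fa hys, ← hfx, ← hfy, h1]

/-- `φ < 2√D` for a reduced quotient (`P < √D`, `Q ≥ 1`). [cite: JacobsonWilliams2008, §3.3 (3.32)] -/
theorem IsReduced.val_lt_two_sqrt {x : QuadIrr D} (h : x.IsReduced) : x.val < 2 * Real.sqrt D := by
  have hQ : (1 : ℝ) ≤ x.Q := by exact_mod_cast h.1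
  have h1 := h.P_lt_sqrt
  have hpos : 0 < (x.P : ℝ) + Real.sqrt D := by
    have := h.P_pos
    have : (0 : ℝ) < x.P := by exact_mod_cast this
    positivity
  unfold val
  calc ((x.P : ℝ) + Real.sqrt D) / x.Q ≤ (x.P + Real.sqrt D) / 1 :=
        div_le_div_of_nonneg_left hpos.le one_pos hQ
    _ < 2 * Real.sqrt D := by rw [div_one]; linarith

/-- `log ∏_{k=1}^{n} φ_k ≤ n · log (2√D)` along the expansion of a pre-reduced quotient.
[cite: JacobsonWilliams2008, §3.3 (3.32)] -/
theorem IsPreReduced.log_valProd_le (hD : ¬ IsSquare D) {x₀ : QuadIrr D} (h : x₀.IsPreReduced) (n : ℕ) :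
    Real.log (valProd x₀ n) ≤ n * Real.log (2 * Real.sqrt D) := by
  unfold valProd
  rw [Real.log_prod]
  · calc ∑ k ∈ Finset.range n, Real.log ((step^[k + 1] x₀).val)
          ≤ ∑ _k ∈ Finset.range n, Real.log (2 * Real.sqrt D) := by
            refine Finset.sum_le_sum fun k _ => ?_
            have hk := h.isReduced_iterate_succ hD k
            exact Real.log_le_log (by linarith [hk.2.2.1]) hk.val_lt_two_sqrt.le
      _ = n * Real.log (2 * Real.sqrt D) := by rw [Finset.sum_const, Finset.card_range, nsmul_eq_mul]
  · intro k _
    have := (h.isReduced_iterate_succ hD k).2.2.1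
    exact (by linarith : (step^[k + 1] x₀).val ≠ 0)

/-- Over a full period of a reduced quotient, `∏ ψ_k = ∏ φ_k` (as `Q_ℓ = Q_0`). [cite: JacobsonWilliams2008, §5.3 (5.34)] -/
theorem psiProd_eq_valProd_of_iterate_eq (hD : ¬ IsSquare D) {x₀ : QuadIrr D} (h : x₀.IsReduced) {ℓ : ℕ}
    (hℓ : step^[ℓ] x₀ = x₀) : psiProd x₀ ℓ = valProd x₀ ℓ := by
  have hQ : (x₀.Q : ℝ) ≠ 0 := by exact_mod_cast h.1.ne'
  rw [psiProd_eq hD h.isAdmissible (h.isPreReduced.isReduced_iterate_succ hD), hℓ, div_self hQ, one_mul]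

end QuadIrr

/-! ## The ideals of `𝓞 K` attached to ideal-shaped quotients

For a `ℤ`-basis `(1, ω)` of `𝓞 K` with `ω² = n + tω` (so `δ = 2ω − t` has `δ² = t² + 4n = D`) and an
ideal-shaped quotient `x = (P + √D)/Q` the attached ideal is
`𝔞(x) = (Q/2, ω − (t − P)/2) = [Q/2, (P + δ)/2]`; we write it out as
`Ideal.span {(fa x : 𝓞 K), b 1 - ((t - x.P) / 2 : ℤ)}` (`fa x = Q/2`), its second generator being
`η(x) = ω − (t − P)/2`. -/

namespace Quadratic

open QuadIrr

section Ring

variable {K : Type*} [Field K]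
variable (b : Basis (Fin 2) ℤ (𝓞 K)) (hb : b 0 = 1) {t n : ℤ} (hω : b 1 * b 1 = (n : 𝓞 K) + (t : 𝓞 K) * b 1)
variable {D : ℕ} (hDt : (D : ℤ) = t ^ 2 + 4 * n)

include hDt in
/-- The form data of an ideal-shaped quotient in the basis `(1, ω)`: `Q = 2A` (`A = fa x`), `P = t − 2k`,
`AC = k² − tk − n`, `η(x) = ω − k` and `𝔞(x) = (A, ω − k)`. [cite: Cox2013, §7.B Thm. 7.7] -/
theorem exists_form_of_isIdealShaped {x : QuadIrr D} (h : x.IsIdealShaped) :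
    ∃ k C : ℤ, 0 < fa x ∧ x.Q = 2 * fa x ∧ x.P = t - 2 * k ∧ fa x * C = k ^ 2 - t * k - n ∧
      b 1 - (((t - x.P) / 2 : ℤ) : 𝓞 K) = b 1 - (k : 𝓞 K) ∧
      Ideal.span {((fa x : ℤ) : 𝓞 K), b 1 - (((t - x.P) / 2 : ℤ) : 𝓞 K)} =
        Ideal.span {((fa x : ℤ) : 𝓞 K), b 1 - (k : 𝓞 K)} := by
  have hsq := sq_sub_eq h
  have hQ := Q_eq_two_mul_fa h
  have hpos : 0 < fa x := by have := h.1; omega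
  -- parity: `P ≡ t (mod 2)`
  have hpar : 2 ∣ t - x.P := by
    have h4 : x.P ^ 2 - t ^ 2 = 4 * (fa x * fc x + n) := by linear_combination hsq + hDt
    rcases Int.even_or_odd (t - x.P) with he | ho
    · exact even_iff_two_dvd.mp he
    · exfalso
      have ho' : Odd (t + x.P) := by
        obtain ⟨r, hr⟩ := ho; exact ⟨r + x.P, by linarith⟩
      have hodd : Odd ((t - x.P) * (t + x.P)) := ho.mul ho'
      have heven : Even ((t - x.P) * (t + x.P)) := ⟨-(2 * (fa x * fc x + n)), by linear_combination -h4⟩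
      exact (Int.not_even_iff_odd.mpr hodd) heven
  obtain ⟨k, hk⟩ := hpar
  refine ⟨k, fc x, hpos, hQ, by linarith, ?_, ?_, ?_⟩
  · have h4 : 4 * (fa x * fc x) = 4 * (k ^ 2 - t * k - n) := by
      have : x.P = t - 2 * k := by linarith
      rw [this] at hsq
      linear_combination -hsq - hDt
    linarith
  · rw [hk, Int.mul_ediv_cancel_left _ two_ne_zero]
  · rw [hk, Int.mul_ediv_cancel_left _ two_ne_zero]

include hb in
/-- The ideal `𝔞(x)` of an ideal-shaped quotient is non-zero (it contains `Q/2 ≠ 0`). [folklore] -/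
theorem span_fa_mem_nonZeroDivisors {x : QuadIrr D} (hQ : 0 < x.Q) (h2 : 2 ∣ x.Q) :
    Ideal.span {((fa x : ℤ) : 𝓞 K), b 1 - (((t - x.P) / 2 : ℤ) : 𝓞 K)} ∈ (Ideal (𝓞 K))⁰ := by
  rw [mem_nonZeroDivisors_iff_ne_zero, Ne, Ideal.zero_eq_bot, Ideal.span_eq_bot]
  intro h
  have h0 := h _ (Set.mem_insert _ _)
  have := intCast_eq_zero_of_basis b hb h0
  unfold fa at this
  omega

include hb in
/-- The generator `η(x) = ω − (t − P)/2` is non-zero (`ω ∉ ℤ`). [folklore] -/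
theorem gen_ne_zero (x : QuadIrr D) : b 1 - (((t - x.P) / 2 : ℤ) : 𝓞 K) ≠ 0 := by
  intro h0
  have h1 : ((-((t - x.P) / 2) : ℤ) : 𝓞 K) + ((1 : ℤ) : 𝓞 K) * b 1 = ((0 : ℤ) : 𝓞 K) := by
    push_cast; linear_combination h0
  exact intCast_add_intCast_mul_ne_intCast b hb one_ne_zero 0 h1

include hDt in
/-- `𝔞(x)` is unchanged by `P ↦ P + jQ` (the ideal depends on `P` only modulo `Q`).
[cite: Jozsa2003, §5 (property (b))] -/
theorem span_fa_shiftP {x : QuadIrr D} (h : x.IsIdealShaped) (j : ℤ) :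
    Ideal.span {((fa (shiftP x j) : ℤ) : 𝓞 K), b 1 - (((t - (shiftP x j).P) / 2 : ℤ) : 𝓞 K)} =
      Ideal.span {((fa x : ℤ) : 𝓞 K), b 1 - (((t - x.P) / 2 : ℤ) : 𝓞 K)} := by
  obtain ⟨k, C, -, hQ, hP, -, -, hI⟩ := exists_form_of_isIdealShaped b hDt h
  obtain ⟨k', C', -, -, hP', -, -, hI'⟩ := exists_form_of_isIdealShaped b hDt (InfraPrimitives.isIdealShaped_shiftP h j)
  rw [hI, hI']
  have hA : fa (shiftP x j) = fa x := rfl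
  have hPP : (shiftP x j).P = x.P + j * x.Q := rfl
  rw [hA]
  apply span_pair_eq_span_pair_of_dvd_sub
  refine ⟨-j, ?_⟩
  rw [hPP, hP, hQ] at hP'
  linarith

include hDt in
/-- `𝔞(normalize x) = 𝔞(x)`. [cite: JacobsonWilliams2008, §5.1 (proof of Thm. 5.9)] -/
theorem span_fa_normalize {x : QuadIrr D} (h : x.IsIdealShaped) :
    Ideal.span {((fa (QuadIrr.normalize x) : ℤ) : 𝓞 K),
        b 1 - (((t - (QuadIrr.normalize x).P) / 2 : ℤ) : 𝓞 K)} =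
      Ideal.span {((fa x : ℤ) : 𝓞 K), b 1 - (((t - x.P) / 2 : ℤ) : 𝓞 K)} :=
  span_fa_shiftP b hDt h _

include hω hDt in
/-- **The baby step in `𝓞 K`: `(A) · 𝔞' = (η') · 𝔞`** for the step `x ↦ x'` (with any quotient `q`)
of ideal-shaped data, `𝔞 = (A, η)`, `𝔞' = (A', η')` — the algebraic form of `ρ(𝔞) = ψ 𝔞`
((5.4)–(5.5)); the key identity is `η η' = AA' + qAη'`. [cite: JacobsonWilliams2008, §5.1 (5.4)–(5.5)] -/
theorem span_fa_mul_span_fa_stepWith {x : QuadIrr D} (h : x.IsIdealShaped) (q : ℤ)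
    (h' : (stepWith x q).IsIdealShaped) :
    Ideal.span {((fa x : ℤ) : 𝓞 K)} *
        Ideal.span {((fa (stepWith x q) : ℤ) : 𝓞 K), b 1 - (((t - (stepWith x q).P) / 2 : ℤ) : 𝓞 K)} =
      Ideal.span {b 1 - (((t - (stepWith x q).P) / 2 : ℤ) : 𝓞 K)} *
        Ideal.span {((fa x : ℤ) : 𝓞 K), b 1 - (((t - x.P) / 2 : ℤ) : 𝓞 K)} := by
  obtain ⟨k, C, -, hQ, hP, -, -, hI⟩ := exists_form_of_isIdealShaped b hDt h
  obtain ⟨k', C', -, hQ', hP', -, hη', hI'⟩ := exists_form_of_isIdealShaped b hDt h'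
  have hPP : (stepWith x q).P = q * x.Q - x.P := rfl
  have hQQ : (stepWith x q).Q * x.Q = (D : ℤ) - (stepWith x q).P ^ 2 := stepWith_Q_mul_Q h.isAdmissible q
  rw [hQ', hQ, hP', hDt] at hQQ
  rw [hQ, hP, hP'] at hPP
  set A := fa x
  set A' := fa (stepWith x q)
  -- integer identities
  have e1 : t = k + k' + q * A := by linarith
  have e2 : A * A' = n + t * k' - k' ^ 2 := by nlinarith
  have e3 : A * A' = n + k * k' + q * A * k' := by rw [e2, e1]; ring
  -- the key identity in `𝓞 K`
  have key : (b 1 - (k' : 𝓞 K)) * (b 1 - (k : 𝓞 K)) =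
      (A : 𝓞 K) * (A' : 𝓞 K) + (q : 𝓞 K) * ((b 1 - (k' : 𝓞 K)) * (A : 𝓞 K)) := by
    have e1' : (t : 𝓞 K) = k + k' + q * A := by rw [e1]; push_cast; ring
    have e3' : (A : 𝓞 K) * A' = n + k * k' + q * A * k' := by rw [← Int.cast_mul, e3]; push_cast; ring
    linear_combination hω + (b 1) * e1' - e3'
  rw [hI, hI', hη', span_singleton_mul_span_pair, span_singleton_mul_span_pair, key,
    Ideal.span_pair_add_mul_left, Ideal.span_pair_comm, mul_comm (b 1 - (k' : 𝓞 K)) (A : 𝓞 K)]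

include hω hDt in
/-- **Iterating the baby step: `(A₀A₁⋯A_{m−1}) · 𝔞_m = (η₁η₂⋯η_m) · 𝔞₀`** along the cycle of a
reduced ideal-shaped `x₀`. [cite: JacobsonWilliams2008, §5.1 (5.10)] -/
theorem span_prod_fa_mul_span_fa_iterate (hD : ¬ IsSquare D) {x : QuadIrr D} (h : x.IsIdealShaped)
    (hr : x.IsReduced) (m : ℕ) :
    Ideal.span {∏ j ∈ Finset.range m, ((fa (step^[j] x) : ℤ) : 𝓞 K)} *
        Ideal.span {((fa (step^[m] x) : ℤ) : 𝓞 K), b 1 - (((t - (step^[m] x).P) / 2 : ℤ) : 𝓞 K)} =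
      Ideal.span {∏ j ∈ Finset.range m, (b 1 - (((t - (step^[j + 1] x).P) / 2 : ℤ) : 𝓞 K))} *
        Ideal.span {((fa x : ℤ) : 𝓞 K), b 1 - (((t - x.P) / 2 : ℤ) : 𝓞 K)} := by
  induction m with
  | zero => simp
  | succ m ih =>
    have hm : (step^[m] x).IsIdealShaped := h.iterate hD hr m
    have hrm : (step^[m] x).IsReduced := isReduced_iterate hD hr m
    have hm1 : (stepWith (step^[m] x) (step^[m] x).pq).IsIdealShaped := hm.step hD hrm.isPreReduced
    have hstep := span_fa_mul_span_fa_stepWith b hω hDt hm _ hm1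
    rw [← step_eq_stepWith] at hstep
    rw [Finset.prod_range_succ, Finset.prod_range_succ, ← Ideal.span_singleton_mul_span_singleton,
      ← Ideal.span_singleton_mul_span_singleton, Function.iterate_succ_apply', mul_assoc, hstep,
      mul_left_comm, ih]
    ring

end Ring

end Quadratic

end Literature.NumberTheory.QuadraticFields

end
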